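/-
COR-CM (cell pub-hodgecm2, stage 2 of the Hodge ladder) — count-neutral KERNEL CENSUS TRANSPORT, degree 16, type ℤ/16,
AUTOMORPHISM form (seat prover-pub-hodgecm2-b23-g35-0, binder prover b23, gen 35→; claim DEG16-CYCLIC; sequel of
`Census/HexadecicFaceTransportCyclic.lean`). Theorems only: the field-closure theorem with the dictionary given on `Aut(K)`
(bridge `FaceCensus.exists_enum_of_autEnum`). No definition, no named fact; `Interfaces.lean` (C1), every E term, B01 and
`Transposition/*` untouched. HONEST FRAMING: `HC_CM` is NOT proved; the theorem is CONDITIONAL on fifteen face periods for ONE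
field. T5: same binder family as the GalT form (dictionary, fifteen face readings — inhabited —, fifteen periods = crux
instances); checker: self (prover-pub-hodgecm2-b23-g35-0), 2026-08-22.
-/
import Summits.HodgeConjecture.CorCM.Census.HexadecicFaceTransportCyclic
import HarnessLib

/-!
# Degree 16, cyclic type `ℤ/16`: the field closure from automorphism data (fifteen face periods)
-/

noncomputable section

open CategoryTheory NumberField NumberField.ComplexEmbedding
open Literature.AlgebraicGeometry Literature.AlgebraicGeometry.Motives Literature.AlgebraicGeometry.HodgeTheory
open Literature.AlgebraicGeometry.ComplexMultiplication Literature.AlgebraicGeometry.Milne1999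
open Literature.NumberTheory.Automorphic
open Literature.NumberTheory.Automorphic.PicardCM
open Summit.HodgeConjecture.CorCM.Domination

namespace Summit.HodgeConjecture.CorCM.HexadecicFaceTransport.Cyclic

open Summit.HodgeConjecture.CorCM.Census.FaceSquaresModel (mem flipAt)
open Summit.HodgeConjecture.CorCM.Census.HexadecicFaceGeneratorsCyclic (Γ genReps certs certsX trans hints)


/-- **FIELD CLOSURE, type `ℤ/16` (cyclic, degree 16; `c = 8`) — from AUTOMORPHISM data (the form a field-specific seat has).** Same
conclusion with the dictionary given on `Aut(K)`: a base embedding `σ₀`, a bijection `ε : Aut(K) ≃ Fin 16` multiplicative for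
b30's table, the automorphism `c` inducing complex conjugation at `σ₀` with `ε c = 8`, and the faces described through `ε` (`σ₀ ∘
g ∈ Rᵢ.Φ ↔ ε g ∈` type mask; place representatives `σ₀ ∘ g_p`, `σ₀ ∘ g_q` with the listed place masks). The enumeration of `GalT
K` is produced by `FaceCensus.exists_enum_of_autEnum` (`CorCM/FaceCensusCells.lean`). (FRAMING: conditional on the face periods;
`HC_CM` is not proved.) [cite: Shimura1998, §6.2 Theorem 3 and §6.1 Corollary of Theorem 2 (pp. 41–43)] [cite: Pohlmann1968, Thm.
1] [cite: Milne1999LefschetzClasses, Thm. 3.2 and Cor. 4.5] [cite: MumfordAV1970, §19 Thm. 1 and p. 169] -/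
theorem hodgeConjectureFor_of_avDominatedBy_isProductOf_of_facePeriod_hexadecicCyclic_aut (K : CMField) [IsGalois ℚ K]
    (σ₀ : (K : Type) →+* ℂ) (ε : ((K : Type) ≃ₐ[ℚ] (K : Type)) ≃ Fin 16)
    (hε : ∀ g h : ((K : Type) ≃ₐ[ℚ] (K : Type)), ε (g * h) = Γ.mul (ε g) (ε h))
    (c : ((K : Type) ≃ₐ[ℚ] (K : Type))) (hc : σ₀.comp (c : (K : Type) →+* (K : Type)) = conjugate σ₀) (hεc : ε c = Γ.conj)
    (R₁ R₂ R₃ R₄ R₅ R₆ R₇ R₈ R₉ R₁₀ R₁₁ R₁₂ R₁₃ R₁₄ R₁₅ : Face K) (g₁ g₁' : ((K : Type) ≃ₐ[ℚ] (K : Type))) (g₂ g₂' : ((K : Type) ≃ₐ[ℚ] (K : Type))) (g₃ g₃' : ((K : Type) ≃ₐ[ℚ] (K : Type))) (g₄ g₄' : ((K : Type) ≃ₐ[ℚ] (K : Type))) (g₅ g₅' : ((K : Type) ≃ₐ[ℚ] (K : Type))) (g₆ g₆' : ((K : Type) ≃ₐ[ℚ] (K : Type))) (g₇ g₇' : ((K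 : Type) ≃ₐ[ℚ] (K : Type))) (g₈ g₈' : ((K : Type) ≃ₐ[ℚ] (K : Type))) (g₉ g₉' : ((K : Type) ≃ₐ[ℚ] (K : Type))) (g₁₀ g₁₀' : ((K : Type) ≃ₐ[ℚ] (K : Type))) (g₁₁ g₁₁' : ((K : Type) ≃ₐ[ℚ] (K : Type))) (g₁₂ g₁₂' : ((K : Type) ≃ₐ[ℚ] (K : Type))) (g₁₃ g₁₃' : ((K : Type) ≃ₐ[ℚ] (K : Type))) (g₁₄ g₁₄' : ((K : Type) ≃ₐ[ℚ] (K : Type))) (g₁₅ g₁₅' : ((K : Type) ≃ₐ[ℚ] (K : Type)))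
    (hΦ₁ : ∀ g : ((K : Type) ≃ₐ[ℚ] (K : Type)),
      σ₀.comp (g : (K : Type) →+* (K : Type)) ∈ R₁.Φ.1 ↔ mem (ε g) 255 = true)
    (hp₁ : R₁.p = σ₀.comp (g₁ : (K : Type) →+* (K : Type))) (hp₁' : Γ.placeMask (ε g₁) = 257)
    (hq₁ : R₁.p' = σ₀.comp (g₁' : (K : Type) →+* (K : Type))) (hq₁' : Γ.placeMask (ε g₁') = 8224)
    (hΦ₂ : ∀ g : ((K : Type) ≃ₐ[ℚ] (K : Type)),
      σ₀.comp (g : (K : Type) →+* (K : Type)) ∈ R₂.Φ.1 ↔ mem (ε g) 255 = true)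
    (hp₂ : R₂.p = σ₀.comp (g₂ : (K : Type) →+* (K : Type))) (hp₂' : Γ.placeMask (ε g₂) = 514)
    (hq₂ : R₂.p' = σ₀.comp (g₂' : (K : Type) →+* (K : Type))) (hq₂' : Γ.placeMask (ε g₂') = 16448)
    (hΦ₃ : ∀ g : ((K : Type) ≃ₐ[ℚ] (K : Type)),
      σ₀.comp (g : (K : Type) →+* (K : Type)) ∈ R₃.Φ.1 ↔ mem (ε g) 255 = true)
    (hp₃ : R₃.p = σ₀.comp (g₃ : (K : Type) →+* (K : Type))) (hp₃' : Γ.placeMask (ε g₃) = 4112)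
    (hq₃ : R₃.p' = σ₀.comp (g₃' : (K : Type) →+* (K : Type))) (hq₃' : Γ.placeMask (ε g₃') = 8224)
    (hΦ₄ : ∀ g : ((K : Type) ≃ₐ[ℚ] (K : Type)),
      σ₀.comp (g : (K : Type) →+* (K : Type)) ∈ R₄.Φ.1 ↔ mem (ε g) 765 = true)
    (hp₄ : R₄.p = σ₀.comp (g₄ : (K : Type) →+* (K : Type))) (hp₄' : Γ.placeMask (ε g₄) = 1028)
    (hq₄ : R₄.p' = σ₀.comp (g₄' : (K : Type) →+* (K : Type))) (hq₄' : Γ.placeMask (ε g₄') = 4112)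
    (hΦ₅ : ∀ g : ((K : Type) ≃ₐ[ℚ] (K : Type)),
      σ₀.comp (g : (K : Type) →+* (K : Type)) ∈ R₅.Φ.1 ↔ mem (ε g) 765 = true)
    (hp₅ : R₅.p = σ₀.comp (g₅ : (K : Type) →+* (K : Type))) (hp₅' : Γ.placeMask (ε g₅) = 1028)
    (hq₅ : R₅.p' = σ₀.comp (g₅' : (K : Type) →+* (K : Type))) (hq₅' : Γ.placeMask (ε g₅') = 32896)
    (hΦ₆ : ∀ g : ((K : Type) ≃ₐ[ℚ] (K : Type)),
      σ₀.comp (g : (K : Type) →+* (K : Type)) ∈ R₆.Φ.1 ↔ mem (ε g) 765 = true)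
    (hp₆ : R₆.p = σ₀.comp (g₆ : (K : Type) →+* (K : Type))) (hp₆' : Γ.placeMask (ε g₆) = 4112)
    (hq₆ : R₆.p' = σ₀.comp (g₆' : (K : Type) →+* (K : Type))) (hq₆' : Γ.placeMask (ε g₆') = 16448)
    (hΦ₇ : ∀ g : ((K : Type) ≃ₐ[ℚ] (K : Type)),
      σ₀.comp (g : (K : Type) →+* (K : Type)) ∈ R₇.Φ.1 ↔ mem (ε g) 1275 = true)
    (hp₇ : R₇.p = σ₀.comp (g₇ : (K : Type) →+* (K : Type))) (hp₇' : Γ.placeMask (ε g₇) = 514)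
    (hq₇ : R₇.p' = σ₀.comp (g₇' : (K : Type) →+* (K : Type))) (hq₇' : Γ.placeMask (ε g₇') = 2056)
    (hΦ₈ : ∀ g : ((K : Type) ≃ₐ[ℚ] (K : Type)),
      σ₀.comp (g : (K : Type) →+* (K : Type)) ∈ R₈.Φ.1 ↔ mem (ε g) 1275 = true)
    (hp₈ : R₈.p = σ₀.comp (g₈ : (K : Type) →+* (K : Type))) (hp₈' : Γ.placeMask (ε g₈) = 514)
    (hq₈ : R₈.p' = σ₀.comp (g₈' : (K : Type) →+* (K : Type))) (hq₈' : Γ.placeMask (ε g₈') = 4112)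
    (hΦ₉ : ∀ g : ((K : Type) ≃ₐ[ℚ] (K : Type)),
      σ₀.comp (g : (K : Type) →+* (K : Type)) ∈ R₉.Φ.1 ↔ mem (ε g) 1275 = true)
    (hp₉ : R₉.p = σ₀.comp (g₉ : (K : Type) →+* (K : Type))) (hp₉' : Γ.placeMask (ε g₉) = 2056)
    (hq₉ : R₉.p' = σ₀.comp (g₉' : (K : Type) →+* (K : Type))) (hq₉' : Γ.placeMask (ε g₉') = 4112)
    (hΦ₁₀ : ∀ g : ((K : Type) ≃ₐ[ℚ] (K : Type)),
      σ₀.comp (g : (K : Type) →+* (K : Type)) ∈ R₁₀.Φ.1 ↔ mem (ε g) 1275 = true)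
    (hp₁₀ : R₁₀.p = σ₀.comp (g₁₀ : (K : Type) →+* (K : Type))) (hp₁₀' : Γ.placeMask (ε g₁₀) = 4112)
    (hq₁₀ : R₁₀.p' = σ₀.comp (g₁₀' : (K : Type) →+* (K : Type))) (hq₁₀' : Γ.placeMask (ε g₁₀') = 8224)
    (hΦ₁₁ : ∀ g : ((K : Type) ≃ₐ[ℚ] (K : Type)),
      σ₀.comp (g : (K : Type) →+* (K : Type)) ∈ R₁₁.Φ.1 ↔ mem (ε g) 1275 = true)
    (hp₁₁ : R₁₁.p = σ₀.comp (g₁₁ : (K : Type) →+* (K : Type))) (hp₁₁' : Γ.placeMask (ε g₁₁) = 8224)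
    (hq₁₁ : R₁₁.p' = σ₀.comp (g₁₁' : (K : Type) →+* (K : Type))) (hq₁₁' : Γ.placeMask (ε g₁₁') = 16448)
    (hΦ₁₂ : ∀ g : ((K : Type) ≃ₐ[ℚ] (K : Type)),
      σ₀.comp (g : (K : Type) →+* (K : Type)) ∈ R₁₂.Φ.1 ↔ mem (ε g) 2295 = true)
    (hp₁₂ : R₁₂.p = σ₀.comp (g₁₂ : (K : Type) →+* (K : Type))) (hp₁₂' : Γ.placeMask (ε g₁₂) = 4112)
    (hq₁₂ : R₁₂.p' = σ₀.comp (g₁₂' : (K : Type) →+* (K : Type))) (hq₁₂' : Γ.placeMask (ε g₁₂') = 32896)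
    (hΦ₁₃ : ∀ g : ((K : Type) ≃ₐ[ℚ] (K : Type)),
      σ₀.comp (g : (K : Type) →+* (K : Type)) ∈ R₁₃.Φ.1 ↔ mem (ε g) 2805 = true)
    (hp₁₃ : R₁₃.p = σ₀.comp (g₁₃ : (K : Type) →+* (K : Type))) (hp₁₃' : Γ.placeMask (ε g₁₃) = 16448)
    (hq₁₃ : R₁₃.p' = σ₀.comp (g₁₃' : (K : Type) →+* (K : Type))) (hq₁₃' : Γ.placeMask (ε g₁₃') = 32896)
    (hΦ₁₄ : ∀ g : ((K : Type) ≃ₐ[ℚ] (K : Type)),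
      σ₀.comp (g : (K : Type) →+* (K : Type)) ∈ R₁₄.Φ.1 ↔ mem (ε g) 4845 = true)
    (hp₁₄ : R₁₄.p = σ₀.comp (g₁₄ : (K : Type) →+* (K : Type))) (hp₁₄' : Γ.placeMask (ε g₁₄) = 2056)
    (hq₁₄ : R₁₄.p' = σ₀.comp (g₁₄' : (K : Type) →+* (K : Type))) (hq₁₄' : Γ.placeMask (ε g₁₄') = 8224)
    (hΦ₁₅ : ∀ g : ((K : Type) ≃ₐ[ℚ] (K : Type)),
      σ₀.comp (g : (K : Type) →+* (K : Type)) ∈ R₁₅.Φ.1 ↔ mem (ε g) 4845 = true)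
    (hp₁₅ : R₁₅.p = σ₀.comp (g₁₅ : (K : Type) →+* (K : Type))) (hp₁₅' : Γ.placeMask (ε g₁₅) = 2056)
    (hq₁₅ : R₁₅.p' = σ₀.comp (g₁₅' : (K : Type) →+* (K : Type))) (hq₁₅' : Γ.placeMask (ε g₁₅') = 32896)
    (h₁ : ∃ ι₁ : K →+* ℂ, R₁.Admissible ι₁ ∧ ∃ (V : HermSpace3 K ι₁) (σ : K →+* ℂ),
      (Model.picardCMUniverse exists_isReal_hodgeModel_holds hodgePQ_independent_of_hodgeModel_holds
        BallQuotient.ballQuotientUniformised_holds cmAbelianVarietyRealised_holds).PeriodNV ι₁ V K R₁.psi σ)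
    (h₂ : ∃ ι₁ : K →+* ℂ, R₂.Admissible ι₁ ∧ ∃ (V : HermSpace3 K ι₁) (σ : K →+* ℂ),
      (Model.picardCMUniverse exists_isReal_hodgeModel_holds hodgePQ_independent_of_hodgeModel_holds
        BallQuotient.ballQuotientUniformised_holds cmAbelianVarietyRealised_holds).PeriodNV ι₁ V K R₂.psi σ)
    (h₃ : ∃ ι₁ : K →+* ℂ, R₃.Admissible ι₁ ∧ ∃ (V : HermSpace3 K ι₁) (σ : K →+* ℂ),
      (Model.picardCMUniverse exists_isReal_hodgeModel_holds hodgePQ_independent_of_hodgeModel_holds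
        BallQuotient.ballQuotientUniformised_holds cmAbelianVarietyRealised_holds).PeriodNV ι₁ V K R₃.psi σ)
    (h₄ : ∃ ι₁ : K →+* ℂ, R₄.Admissible ι₁ ∧ ∃ (V : HermSpace3 K ι₁) (σ : K →+* ℂ),
      (Model.picardCMUniverse exists_isReal_hodgeModel_holds hodgePQ_independent_of_hodgeModel_holds
        BallQuotient.ballQuotientUniformised_holds cmAbelianVarietyRealised_holds).PeriodNV ι₁ V K R₄.psi σ)
    (h₅ : ∃ ι₁ : K →+* ℂ, R₅.Admissible ι₁ ∧ ∃ (V : HermSpace3 K ι₁) (σ : K →+* ℂ),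
      (Model.picardCMUniverse exists_isReal_hodgeModel_holds hodgePQ_independent_of_hodgeModel_holds
        BallQuotient.ballQuotientUniformised_holds cmAbelianVarietyRealised_holds).PeriodNV ι₁ V K R₅.psi σ)
    (h₆ : ∃ ι₁ : K →+* ℂ, R₆.Admissible ι₁ ∧ ∃ (V : HermSpace3 K ι₁) (σ : K →+* ℂ),
      (Model.picardCMUniverse exists_isReal_hodgeModel_holds hodgePQ_independent_of_hodgeModel_holds
        BallQuotient.ballQuotientUniformised_holds cmAbelianVarietyRealised_holds).PeriodNV ι₁ V K R₆.psi σ)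
    (h₇ : ∃ ι₁ : K →+* ℂ, R₇.Admissible ι₁ ∧ ∃ (V : HermSpace3 K ι₁) (σ : K →+* ℂ),
      (Model.picardCMUniverse exists_isReal_hodgeModel_holds hodgePQ_independent_of_hodgeModel_holds
        BallQuotient.ballQuotientUniformised_holds cmAbelianVarietyRealised_holds).PeriodNV ι₁ V K R₇.psi σ)
    (h₈ : ∃ ι₁ : K →+* ℂ, R₈.Admissible ι₁ ∧ ∃ (V : HermSpace3 K ι₁) (σ : K →+* ℂ),
      (Model.picardCMUniverse exists_isReal_hodgeModel_holds hodgePQ_independent_of_hodgeModel_holds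
        BallQuotient.ballQuotientUniformised_holds cmAbelianVarietyRealised_holds).PeriodNV ι₁ V K R₈.psi σ)
    (h₉ : ∃ ι₁ : K →+* ℂ, R₉.Admissible ι₁ ∧ ∃ (V : HermSpace3 K ι₁) (σ : K →+* ℂ),
      (Model.picardCMUniverse exists_isReal_hodgeModel_holds hodgePQ_independent_of_hodgeModel_holds
        BallQuotient.ballQuotientUniformised_holds cmAbelianVarietyRealised_holds).PeriodNV ι₁ V K R₉.psi σ)
    (h₁₀ : ∃ ι₁ : K →+* ℂ, R₁₀.Admissible ι₁ ∧ ∃ (V : HermSpace3 K ι₁) (σ : K →+* ℂ),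
      (Model.picardCMUniverse exists_isReal_hodgeModel_holds hodgePQ_independent_of_hodgeModel_holds
        BallQuotient.ballQuotientUniformised_holds cmAbelianVarietyRealised_holds).PeriodNV ι₁ V K R₁₀.psi σ)
    (h₁₁ : ∃ ι₁ : K →+* ℂ, R₁₁.Admissible ι₁ ∧ ∃ (V : HermSpace3 K ι₁) (σ : K →+* ℂ),
      (Model.picardCMUniverse exists_isReal_hodgeModel_holds hodgePQ_independent_of_hodgeModel_holds
        BallQuotient.ballQuotientUniformised_holds cmAbelianVarietyRealised_holds).PeriodNV ι₁ V K R₁₁.psi σ)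
    (h₁₂ : ∃ ι₁ : K →+* ℂ, R₁₂.Admissible ι₁ ∧ ∃ (V : HermSpace3 K ι₁) (σ : K →+* ℂ),
      (Model.picardCMUniverse exists_isReal_hodgeModel_holds hodgePQ_independent_of_hodgeModel_holds
        BallQuotient.ballQuotientUniformised_holds cmAbelianVarietyRealised_holds).PeriodNV ι₁ V K R₁₂.psi σ)
    (h₁₃ : ∃ ι₁ : K →+* ℂ, R₁₃.Admissible ι₁ ∧ ∃ (V : HermSpace3 K ι₁) (σ : K →+* ℂ),
      (Model.picardCMUniverse exists_isReal_hodgeModel_holds hodgePQ_independent_of_hodgeModel_holds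
        BallQuotient.ballQuotientUniformised_holds cmAbelianVarietyRealised_holds).PeriodNV ι₁ V K R₁₃.psi σ)
    (h₁₄ : ∃ ι₁ : K →+* ℂ, R₁₄.Admissible ι₁ ∧ ∃ (V : HermSpace3 K ι₁) (σ : K →+* ℂ),
      (Model.picardCMUniverse exists_isReal_hodgeModel_holds hodgePQ_independent_of_hodgeModel_holds
        BallQuotient.ballQuotientUniformised_holds cmAbelianVarietyRealised_holds).PeriodNV ι₁ V K R₁₄.psi σ)
    (h₁₅ : ∃ ι₁ : K →+* ℂ, R₁₅.Admissible ι₁ ∧ ∃ (V : HermSpace3 K ι₁) (σ : K →+* ℂ),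
      (Model.picardCMUniverse exists_isReal_hodgeModel_holds hodgePQ_independent_of_hodgeModel_holds
        BallQuotient.ballQuotientUniformised_holds cmAbelianVarietyRealised_holds).PeriodNV ι₁ V K R₁₅.psi σ)
    {P A : AbelianVariety ℂ} (hP : AbelianVariety.IsProductOf (fun B : AbelianVariety ℂ =>
      ∃ (E : Type) (_ : Field E) (_ : NumberField E) (_ : IsCMField E) (_ : E →+* (K : Type)) (Φ : CMType E)
        (ι : 𝓞 E →+* End B) (θ : E →+* Module.End ℂ (complexBetti B.X 1)),
        IsCMTypeRealisation Φ B ι θ) P)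
    (hA : AVDominatedBy A P) : HodgeConjectureFor A.dim A.X := by
  obtain ⟨e, hmul, he⟩ := FaceCensus.exists_enum_of_autEnum Γ σ₀ ε hε
  have hconj : e conjT = Γ.conj := by rw [FaceCensus.conjT_eq_translate σ₀, ← hc, he, hεc]
  exact hodgeConjectureFor_of_avDominatedBy_isProductOf_of_facePeriod_hexadecicCyclic K e hmul hconj σ₀ R₁ R₂ R₃ R₄ R₅ R₆ R₇ R₈ R₉ R₁₀ R₁₁ R₁₂ R₁₃ R₁₄ R₁₅
    (FaceCensus.reads_of_autEnum Γ e σ₀ ε he R₁ hΦ₁ hp₁ hp₁' hq₁ hq₁')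
    (FaceCensus.reads_of_autEnum Γ e σ₀ ε he R₂ hΦ₂ hp₂ hp₂' hq₂ hq₂')
    (FaceCensus.reads_of_autEnum Γ e σ₀ ε he R₃ hΦ₃ hp₃ hp₃' hq₃ hq₃')
    (FaceCensus.reads_of_autEnum Γ e σ₀ ε he R₄ hΦ₄ hp₄ hp₄' hq₄ hq₄')
    (FaceCensus.reads_of_autEnum Γ e σ₀ ε he R₅ hΦ₅ hp₅ hp₅' hq₅ hq₅')
    (FaceCensus.reads_of_autEnum Γ e σ₀ ε he R₆ hΦ₆ hp₆ hp₆' hq₆ hq₆')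
    (FaceCensus.reads_of_autEnum Γ e σ₀ ε he R₇ hΦ₇ hp₇ hp₇' hq₇ hq₇')
    (FaceCensus.reads_of_autEnum Γ e σ₀ ε he R₈ hΦ₈ hp₈ hp₈' hq₈ hq₈')
    (FaceCensus.reads_of_autEnum Γ e σ₀ ε he R₉ hΦ₉ hp₉ hp₉' hq₉ hq₉')
    (FaceCensus.reads_of_autEnum Γ e σ₀ ε he R₁₀ hΦ₁₀ hp₁₀ hp₁₀' hq₁₀ hq₁₀')
    (FaceCensus.reads_of_autEnum Γ e σ₀ ε he R₁₁ hΦ₁₁ hp₁₁ hp₁₁' hq₁₁ hq₁₁')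
    (FaceCensus.reads_of_autEnum Γ e σ₀ ε he R₁₂ hΦ₁₂ hp₁₂ hp₁₂' hq₁₂ hq₁₂')
    (FaceCensus.reads_of_autEnum Γ e σ₀ ε he R₁₃ hΦ₁₃ hp₁₃ hp₁₃' hq₁₃ hq₁₃')
    (FaceCensus.reads_of_autEnum Γ e σ₀ ε he R₁₄ hΦ₁₄ hp₁₄ hp₁₄' hq₁₄ hq₁₄')
    (FaceCensus.reads_of_autEnum Γ e σ₀ ε he R₁₅ hΦ₁₅ hp₁₅ hp₁₅' hq₁₅ hq₁₅')
    h₁ h₂ h₃ h₄ h₅ h₆ h₇ h₈ h₉ h₁₀ h₁₁ h₁₂ h₁₃ h₁₄ h₁₅ hP hA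

end Summit.HodgeConjecture.CorCM.HexadecicFaceTransport.Cyclic

end
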